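import Summits.Ventures.CertifiedArithmetic.Expansions.Orient2dStageCBounds
import Summits.Ventures.CertifiedArithmetic.Expansions.Orient2dDetBApprox
import Mathlib.Tactic.Linarith
import Mathlib.Tactic.Positivity
import Mathlib.Tactic.Ring
import Mathlib.Tactic.NormNum

/-!
# Stage C of ORIENT2D, part 2: the stage-C test of `orient2dadapt` is sound

NEW WORK in the sense of this development (algorithm and constants: Shewchuk, `predicates.c` and
Table 1 line C; statement of correctness in this model and proof: ours).

* `orient2dStageC_correct` — **if stage A fell through and stage C returns `d`
  (`|det'| ≥ (ccwerrboundC ⊗ detsum) ⊕ (resulterrbound ⊗ |det|)`), then `d > 0 ↔ t_A > 0` and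
  `d < 0 ↔ t_A < 0`** for the true determinant `t_A = (a₁ − c₁)(b₂ − c₂) − (a₂ − c₂)(b₁ − c₁)`:
  any precision `p ≥ 4`, any round-to-nearest with the `RoundoffBelow 2` property (e.g. ties-to-even),
  coordinates in a format `F(p, e₀)` with `emin ≤ e₀` and `emin + 3p ≤ 2e₀` (one `p` more than stages
  A and B ask for: the product `ccwerrboundC ⊗ detsum` lives on the grid `2^(2e₀ − 3p) ℤ`), error-free
  two-products on the rounded differences, the four tails taken exactly (TWO-DIFF-TAIL,
  `twoDiff_exact`).  Whether stage B answered before is irrelevant to the statement.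
  Proof: `stageC_sign_of_bounds` (part 1) fed with `abs_orient2dDetB_sub_le` (`Orient2dDetBApprox`)
  and the standard-model roundoff facts of the eleven floating-point operations of stage C.

STATE OF THE `orient2d` CERTIFICATION after this file: stages A, B, C, the tails-zero exit's strict
signs and the exactness of stage D are machine-checked; NOT verified: that the tails-zero exit cannot
return `0` for a nonzero determinant (reduced to one configuration in `Orient2dEstimateZero.lean`).
HONEST CAVEATS: overflow is not modelled; the format hypothesis excludes the gradual-underflow range
(binary64: coordinates multiples of `2^−457`).

References: J. R. Shewchuk, Discrete Comput. Geom. 18 (1997) 305–363, §4.3 (Fig. 21, Table 1) and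
`predicates.c` (`orient2dadapt`) [Shewchuk1997].
-/

namespace Summit.Ventures.CertifiedArithmetic.Expansions

open Literature.ComputerArithmetic.JeannerodRump2018
open Literature.ComputerArithmetic.BoldoJeannerodMelquiondMuller2023 hiding twoSum twoSum_fst isFloat_twoSum
open Literature.ComputerArithmetic.Shewchuk1997

variable {p : ℕ} {emin : ℤ} {fl : ℚ → ℚ}

/-! ## The stage-C test is sound -/

/-- `|t| ≤ u|y|` and `|x y| ≤ w` give `|x t| ≤ u w` (the size of a product `difference ⊗ tail`). -/
theorem abs_mul_le_of_abs_le_mul {x t y u w : ℚ} (ht : |t| ≤ u * |y|) (hu : 0 ≤ u)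
    (hxy : |x * y| ≤ w) : |x * t| ≤ u * w := by
  rw [abs_mul] at hxy ⊢
  calc |x| * |t| ≤ |x| * (u * |y|) := mul_le_mul_of_nonneg_left ht (abs_nonneg _)
    _ = u * (|x| * |y|) := by ring
    _ ≤ u * w := mul_le_mul_of_nonneg_left hxy hu

set_option maxHeartbeats 400000 in
/-- **THE STAGE-C TEST OF `orient2dadapt` IS SOUND** (Table 1, line C: `ccwerrboundC = (9 + 64ε)ε²`,
`resulterrbound = (3 + 8ε)ε`).  Let `p ≥ 4`, `fl` any round-to-nearest into `F(p, emin)` with the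
`RoundoffBelow 2` property, the six coordinates floats of a format `F(p, e₀)` with `emin ≤ e₀` and
`emin + 3p ≤ 2e₀`, and the two-product routine error-free on the rounded differences.  If stage A fell
through (any coefficient) and stage C returns `d`, then `d > 0 ↔ t_A > 0` and `d < 0 ↔ t_A < 0` for the
TRUE determinant; in particular `d ≠ 0` and the returned sign is the true sign. -/
theorem orient2dStageC_correct (hp : 4 ≤ p) (hfl : IsRoundNearest p emin fl)
    (hfl2 : RoundoffBelow 2 fl) {e₀ : ℤ} (he₀ : emin ≤ e₀) (h3 : emin + 3 * p ≤ e₀ + e₀)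
    {a₁ a₂ b₁ b₂ c₁ c₂ : ℚ} (ha₁ : IsFloat p e₀ a₁) (ha₂ : IsFloat p e₀ a₂) (hb₁ : IsFloat p e₀ b₁)
    (hb₂ : IsFloat p e₀ b₂) (hc₁ : IsFloat p e₀ c₁) (hc₂ : IsFloat p e₀ c₂)
    {tp : ℚ → ℚ → ℚ × ℚ} (h₁₂ : ExactTwoProd p emin fl tp (fl (a₁ - c₁)) (fl (b₂ - c₂)))
    (h₃₄ : ExactTwoProd p emin fl tp (fl (a₂ - c₂)) (fl (b₁ - c₁))) {K : ℚ}
    (hA : orient2dStageA fl K a₁ a₂ b₁ b₂ c₁ c₂ = none) {d : ℚ}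
    (hC : orient2dStageC tp fl (ccwerrboundC p) (resulterrbound p)
      (orient2dDetsum fl a₁ a₂ b₁ b₂ c₁ c₂) a₁ a₂ b₁ b₂ c₁ c₂ = some d) :
    (0 < d ↔ 0 < (a₁ - c₁) * (b₂ - c₂) - (a₂ - c₂) * (b₁ - c₁)) ∧
      (d < 0 ↔ (a₁ - c₁) * (b₂ - c₂) - (a₂ - c₂) * (b₁ - c₁) < 0) := by
  have hp1 : 1 ≤ p := le_trans (by norm_num) hp
  have h2 : emin + 2 * p ≤ e₀ + e₀ := by omega
  have he₂ : emin ≤ e₀ + e₀ := by omega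
  have he₃ : emin ≤ -(2 * (p : ℤ)) + (e₀ + e₀) := by omega
  have he₄ : emin ≤ -(3 * (p : ℤ)) + (e₀ + e₀) := by omega
  -- facts stated before the abbreviations are introduced (so that `set` rewrites them)
  have hdB := abs_orient2dDetB_sub_le hp hfl hfl2 he₀ h2 ha₁ ha₂ hb₁ hb₂ hc₁ hc₂ h₁₂ h₃₄
  have hKC : (1 - unitRoundoff p) * ((9 + 64 * unitRoundoff p) * unitRoundoff p ^ 2) ≤
      ccwerrboundC p := by
    have h0 : 0 ≤ unitRoundoff p * ((9 + 64 * unitRoundoff p) * unitRoundoff p ^ 2) := by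
      unfold unitRoundoff; positivity
    unfold ccwerrboundC
    nlinarith [h0]
  have hKR : (1 - unitRoundoff p) * ((3 + 8 * unitRoundoff p) * unitRoundoff p) ≤
      resulterrbound p := by
    have h0 : 0 ≤ unitRoundoff p * ((3 + 8 * unitRoundoff p) * unitRoundoff p) := by
      unfold unitRoundoff; positivity
    unfold resulterrbound
    nlinarith [h0]
  have hKC0 : 0 < ccwerrboundC p := by unfold ccwerrboundC unitRoundoff; positivity
  have hKR0 : 0 ≤ resulterrbound p := by unfold resulterrbound unitRoundoff; positivity
  -- stage C returned: the test passed and `d = det'`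
  unfold orient2dStageC at hC
  simp only [] at hC
  split_ifs at hC with hT
  obtain rfl := Option.some.inj hC
  set u := unitRoundoff p with hu_def
  have hu0 : 0 < u := by rw [hu_def]; unfold unitRoundoff; positivity
  have hu16 : u ≤ 1 / 16 := Literature.ComputerArithmetic.BoldoMuller2011.unitRoundoff_le_sixteenth hp
  have hu1 : u < 1 := by linarith
  -- the quantities of the analysis
  set t₁ := a₁ - c₁ with ht₁
  set t₂ := b₂ - c₂ with ht₂
  set t₃ := a₂ - c₂ with ht₃
  set t₄ := b₁ - c₁ with ht₄
  set x₁ := fl t₁ with hx₁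
  set x₂ := fl t₂ with hx₂
  set x₃ := fl t₃ with hx₃
  set x₄ := fl t₄ with hx₄
  set x₅ := fl (x₁ * x₂) with hx₅
  set x₆ := fl (x₃ * x₄) with hx₆
  set S := orient2dDetsum fl a₁ a₂ b₁ b₂ c₁ c₂ with hS_def
  set det := orient2dDetB tp fl a₁ a₂ b₁ b₂ c₁ c₂ with hdet_def
  set KC := ccwerrboundC p with hKC_def
  set KR := resulterrbound p with hKR_def
  -- grids and floats
  have gt₁ : OnGrid e₀ t₁ := (OnGrid.of_isFloat ha₁).sub (OnGrid.of_isFloat hc₁)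
  have gt₂ : OnGrid e₀ t₂ := (OnGrid.of_isFloat hb₂).sub (OnGrid.of_isFloat hc₂)
  have gt₃ : OnGrid e₀ t₃ := (OnGrid.of_isFloat ha₂).sub (OnGrid.of_isFloat hc₂)
  have gt₄ : OnGrid e₀ t₄ := (OnGrid.of_isFloat hb₁).sub (OnGrid.of_isFloat hc₁)
  have gx₁ : OnGrid e₀ x₁ := gt₁.fl_of hp1 hfl he₀
  have gx₂ : OnGrid e₀ x₂ := gt₂.fl_of hp1 hfl he₀
  have gx₃ : OnGrid e₀ x₃ := gt₃.fl_of hp1 hfl he₀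
  have gx₄ : OnGrid e₀ x₄ := gt₄.fl_of hp1 hfl he₀
  have g₁₂ : OnGrid (e₀ + e₀) (x₁ * x₂) := gx₁.mul gx₂
  have g₃₄ : OnGrid (e₀ + e₀) (x₃ * x₄) := gx₃.mul gx₄
  have gx₅ : OnGrid (e₀ + e₀) x₅ := g₁₂.fl_of hp1 hfl he₂
  have gx₆ : OnGrid (e₀ + e₀) x₆ := g₃₄.fl_of hp1 hfl he₂
  have hx5F : IsFloat p emin x₅ := (hfl _).1
  have hx6F : IsFloat p emin x₆ := (hfl _).1
  -- `det` lies on the grid `2^(2e₀) ℤ` (every quantity of block `B` does)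
  have gdet : OnGrid (e₀ + e₀) det := by
    have hx5e : (tp x₁ x₂).1 = x₅ := h₁₂.1
    have hx6e : (tp x₃ x₄).1 = x₆ := h₃₄.1
    have ha0 : (tp x₁ x₂).2 = x₁ * x₂ - x₅ := by have := h₁₂.2.1; rw [hx5e] at this; linarith
    have hb0 : (tp x₃ x₄).2 = x₃ * x₄ - x₆ := by have := h₃₄.2.1; rw [hx6e] at this; linarith
    have ga0 : OnGrid (e₀ + e₀) (tp x₁ x₂).2 := by rw [ha0]; exact g₁₂.sub gx₅
    have gb0 : OnGrid (e₀ + e₀) (tp x₃ x₄).2 := by rw [hb0]; exact g₃₄.sub gx₆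
    have hblock : twoTwoProdDiff tp fl x₁ x₂ x₃ x₄ = twoTwoDiff fl x₅ (tp x₁ x₂).2 x₆ (tp x₃ x₄).2 := by
      show twoTwoDiff fl (tp x₁ x₂).1 (tp x₁ x₂).2 (tp x₃ x₄).1 (tp x₃ x₄).2 = _
      rw [hx5e, hx6e]
    rw [twoTwoDiff_eq] at hblock
    have e1 := (twoSum_exact hp1 hfl h₃₄.2.2.neg h₁₂.2.2).2
    set T1 := twoSum fl (-(tp x₃ x₄).2) (tp x₁ x₂).2 with hT1
    have gT11 : OnGrid (e₀ + e₀) T1.1 := (gb0.neg.add ga0).fl_of hp1 hfl he₂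
    have gT12 : OnGrid (e₀ + e₀) T1.2 := by
      rw [(by linarith : T1.2 = -(tp x₃ x₄).2 + (tp x₁ x₂).2 - T1.1)]; exact (gb0.neg.add ga0).sub gT11
    have hT1F := isFloat_twoSum hfl (-(tp x₃ x₄).2) (tp x₁ x₂).2
    have e2 := (twoSum_exact hp1 hfl hT1F.1 hx5F).2
    set T2 := twoSum fl T1.1 x₅ with hT2
    have gT21 : OnGrid (e₀ + e₀) T2.1 := (gT11.add gx₅).fl_of hp1 hfl he₂
    have gT22 : OnGrid (e₀ + e₀) T2.2 := by
      rw [(by linarith : T2.2 = T1.1 + x₅ - T2.1)]; exact (gT11.add gx₅).sub gT21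
    have hT2F := isFloat_twoSum hfl T1.1 x₅
    have e3 := (twoSum_exact hp1 hfl hx6F.neg hT2F.2).2
    set T3 := twoSum fl (-x₆) T2.2 with hT3
    have gT31 : OnGrid (e₀ + e₀) T3.1 := (gx₆.neg.add gT22).fl_of hp1 hfl he₂
    have gT32 : OnGrid (e₀ + e₀) T3.2 := by
      rw [(by linarith : T3.2 = -x₆ + T2.2 - T3.1)]; exact (gx₆.neg.add gT22).sub gT31
    have hT3F := isFloat_twoSum hfl (-x₆) T2.2
    have e4 := (twoSum_exact hp1 hfl hT3F.1 hT2F.1).2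
    set T4 := twoSum fl T3.1 T2.1 with hT4
    have gT41 : OnGrid (e₀ + e₀) T4.1 := (gT31.add gT21).fl_of hp1 hfl he₂
    have gT42 : OnGrid (e₀ + e₀) T4.2 := by
      rw [(by linarith : T4.2 = T3.1 + T2.1 - T4.1)]; exact (gT31.add gT21).sub gT41
    have hdet : det = fl (fl (fl (T1.2 + T3.2) + T4.2) + T4.1) := by
      show estimate fl (twoTwoProdDiff tp fl x₁ x₂ x₃ x₄) = _
      rw [hblock, estimate_four]
    rw [hdet]
    exact ((((gT12.add gT32).fl_of hp1 hfl he₂).add gT42).fl_of hp1 hfl he₂ |>.add gT41).fl_of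
      hp1 hfl he₂
  -- what the fall-through of stage A gives: `detsum = s ± εs` on the grid `2^2e₀ ℤ`, `s > 0`
  have hft : (0 < x₅ ∧ 0 < x₆) ∨ (x₅ < 0 ∧ x₆ < 0) := orient2dStageA_eq_none hA
  have hSdef : S = if 0 < x₅ then fl (x₅ + x₆) else fl (-x₅ - x₆) := rfl
  have hSum : |(|x₅| + |x₆|) - S| ≤ u * (|x₅| + |x₆|) ∧ OnGrid (e₀ + e₀) S ∧ 0 < |x₅| + |x₆| := by
    rcases hft with ⟨h5, h6⟩ | ⟨h5, h6⟩
    · rw [hSdef, if_pos h5]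
      have hsum : |x₅| + |x₆| = x₅ + x₆ := by rw [abs_of_pos h5, abs_of_pos h6]
      have hpos : 0 < x₅ + x₆ := by linarith
      refine ⟨?_, (gx₅.add gx₆).fl_of hp1 hfl he₂, by linarith⟩
      have h := abs_sub_fl_le_eps_mul_abs hp1 hfl he₂ (gx₅.add gx₆)
      rw [abs_of_pos hpos] at h
      rw [hsum]; exact h
    · rw [hSdef, if_neg (not_lt.mpr h5.le)]
      have hsum : |x₅| + |x₆| = -x₅ - x₆ := by rw [abs_of_neg h5, abs_of_neg h6]; ring
      have hpos : 0 < -x₅ - x₆ := by linarith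
      refine ⟨?_, (gx₅.neg.sub gx₆).fl_of hp1 hfl he₂, by linarith⟩
      have h := abs_sub_fl_le_eps_mul_abs hp1 hfl he₂ (gx₅.neg.sub gx₆)
      rw [abs_of_pos hpos] at h
      rw [hsum]; exact h
  obtain ⟨hS, gS, hs⟩ := hSum
  set s := |x₅| + |x₆| with hs_def
  -- the tails and their sizes
  set τ₁ := t₁ - x₁ with hτ₁
  set τ₂ := t₂ - x₂ with hτ₂
  set τ₃ := t₃ - x₃ with hτ₃
  set τ₄ := t₄ - x₄ with hτ₄
  have gτ₁ : OnGrid e₀ τ₁ := gt₁.sub gx₁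
  have gτ₂ : OnGrid e₀ τ₂ := gt₂.sub gx₂
  have gτ₃ : OnGrid e₀ τ₃ := gt₃.sub gx₃
  have gτ₄ : OnGrid e₀ τ₄ := gt₄.sub gx₄
  have rτ₁ : |τ₁| ≤ u * |x₁| := abs_sub_fl_le_eps_mul_abs_fl hp1 hfl he₀ gt₁
  have rτ₂ : |τ₂| ≤ u * |x₂| := abs_sub_fl_le_eps_mul_abs_fl hp1 hfl he₀ gt₂
  have rτ₃ : |τ₃| ≤ u * |x₃| := abs_sub_fl_le_eps_mul_abs_fl hp1 hfl he₀ gt₃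
  have rτ₄ : |τ₄| ≤ u * |x₄| := abs_sub_fl_le_eps_mul_abs_fl hp1 hfl he₀ gt₄
  have hP5 : |x₁ * x₂| ≤ (1 + u) * |x₅| := by
    have h := abs_sub_fl_le_eps_mul_abs_fl hp1 hfl he₂ g₁₂
    have := abs_sub_abs_le_abs_sub (x₁ * x₂) x₅
    linarith
  have hP6 : |x₃ * x₄| ≤ (1 + u) * |x₆| := by
    have h := abs_sub_fl_le_eps_mul_abs_fl hp1 hfl he₂ g₃₄
    have := abs_sub_abs_le_abs_sub (x₃ * x₄) x₆
    linarith
  -- the four products of stage C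
  set P₁ := x₁ * τ₂ with hP₁
  set P₂ := x₂ * τ₁ with hP₂
  set P₃ := x₃ * τ₄ with hP₃
  set P₄ := x₄ * τ₃ with hP₄
  have gP₁ : OnGrid (e₀ + e₀) P₁ := gx₁.mul gτ₂
  have gP₂ : OnGrid (e₀ + e₀) P₂ := gx₂.mul gτ₁
  have gP₃ : OnGrid (e₀ + e₀) P₃ := gx₃.mul gτ₄
  have gP₄ : OnGrid (e₀ + e₀) P₄ := gx₄.mul gτ₃
  have hP5' : |x₂ * x₁| ≤ (1 + u) * |x₅| := by rw [mul_comm]; exact hP5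
  have hP6' : |x₄ * x₃| ≤ (1 + u) * |x₆| := by rw [mul_comm]; exact hP6
  have bP₁ : |P₁| ≤ u * ((1 + u) * |x₅|) := abs_mul_le_of_abs_le_mul rτ₂ hu0.le hP5
  have bP₂ : |P₂| ≤ u * ((1 + u) * |x₅|) := abs_mul_le_of_abs_le_mul rτ₁ hu0.le hP5'
  have bP₃ : |P₃| ≤ u * ((1 + u) * |x₆|) := abs_mul_le_of_abs_le_mul rτ₄ hu0.le hP6
  have bP₄ : |P₄| ≤ u * ((1 + u) * |x₆|) := abs_mul_le_of_abs_le_mul rτ₃ hu0.le hP6'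
  -- the roundings of stage C
  set f₁ := fl P₁ with hf₁
  set f₂ := fl P₂ with hf₂
  set f₃ := fl P₃ with hf₃
  set f₄ := fl P₄ with hf₄
  have gf₁ : OnGrid (e₀ + e₀) f₁ := gP₁.fl_of hp1 hfl he₂
  have gf₂ : OnGrid (e₀ + e₀) f₂ := gP₂.fl_of hp1 hfl he₂
  have gf₃ : OnGrid (e₀ + e₀) f₃ := gP₃.fl_of hp1 hfl he₂
  have gf₄ : OnGrid (e₀ + e₀) f₄ := gP₄.fl_of hp1 hfl he₂
  have rf₁ : |P₁ - f₁| ≤ u * |P₁| := abs_sub_fl_le_eps_mul_abs hp1 hfl he₂ gP₁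
  have rf₂ : |P₂ - f₂| ≤ u * |P₂| := abs_sub_fl_le_eps_mul_abs hp1 hfl he₂ gP₂
  have rf₃ : |P₃ - f₃| ≤ u * |P₃| := abs_sub_fl_le_eps_mul_abs hp1 hfl he₂ gP₃
  have rf₄ : |P₄ - f₄| ≤ u * |P₄| := abs_sub_fl_le_eps_mul_abs hp1 hfl he₂ gP₄
  set m₁ := fl (f₁ + f₂) with hm₁
  set m₂ := fl (f₃ + f₄) with hm₂
  have gm₁ : OnGrid (e₀ + e₀) m₁ := (gf₁.add gf₂).fl_of hp1 hfl he₂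
  have gm₂ : OnGrid (e₀ + e₀) m₂ := (gf₃.add gf₄).fl_of hp1 hfl he₂
  have rm₁ : |f₁ + f₂ - m₁| ≤ u * |f₁ + f₂| := abs_sub_fl_le_eps_mul_abs hp1 hfl he₂ (gf₁.add gf₂)
  have rm₂ : |f₃ + f₄ - m₂| ≤ u * |f₃ + f₄| := abs_sub_fl_le_eps_mul_abs hp1 hfl he₂ (gf₃.add gf₄)
  set c := fl (m₁ - m₂) with hc
  have gc : OnGrid (e₀ + e₀) c := (gm₁.sub gm₂).fl_of hp1 hfl he₂
  have rc : |m₁ - m₂ - c| ≤ u * |c| := abs_sub_fl_le_eps_mul_abs_fl hp1 hfl he₂ (gm₁.sub gm₂)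
  have rc' : |m₁ - m₂ - c| ≤ u * |m₁ - m₂| := abs_sub_fl_le_eps_mul_abs hp1 hfl he₂ (gm₁.sub gm₂)
  set dC := fl (det + c) with hdC
  have rdC : |det + c - dC| ≤ u * |dC| := abs_sub_fl_le_eps_mul_abs_fl hp1 hfl he₂ (gdet.add gc)
  -- the computed error bound
  set E₁ := fl (KC * S) with hE₁
  set E₂ := fl (KR * |det|) with hE₂
  set E := fl (E₁ + E₂) with hE
  have gKS : OnGrid (-(3 * (p : ℤ)) + (e₀ + e₀)) (KC * S) := (onGrid_ccwerrboundC p).mul gS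
  have gKd : OnGrid (-(2 * (p : ℤ)) + (e₀ + e₀)) (KR * |det|) :=
    (onGrid_resulterrbound p).mul gdet.abs
  have gE₁ : OnGrid (-(3 * (p : ℤ)) + (e₀ + e₀)) E₁ := gKS.fl_of hp1 hfl he₄
  have gE₂ : OnGrid (-(3 * (p : ℤ)) + (e₀ + e₀)) E₂ := (gKd.fl_of hp1 hfl he₃).mono (by omega)
  have hS0 : 0 ≤ S := by
    have h1 := (abs_sub_le_iff.mp hS).1
    have h2 : 0 ≤ (1 - u) * s := mul_nonneg (by linarith) hs.le
    linarith
  have rE₁ : (1 - u) * (KC * S) ≤ E₁ := by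
    have h := (abs_sub_le_iff.mp (abs_sub_fl_le_eps_mul_abs hp1 hfl he₄ gKS)).1
    rw [abs_of_nonneg (mul_nonneg hKC0.le hS0)] at h
    rw [hE₁]; linarith
  have rE₂ : (1 - u) * (KR * |det|) ≤ E₂ := by
    have h := (abs_sub_le_iff.mp (abs_sub_fl_le_eps_mul_abs hp1 hfl he₃ gKd)).1
    rw [abs_of_nonneg (mul_nonneg hKR0 (abs_nonneg det))] at h
    rw [hE₂]; linarith
  have hE12 : 0 ≤ E₁ + E₂ := by
    have h1 : 0 ≤ (1 - u) * (KC * S) := mul_nonneg (by linarith) (mul_nonneg hKC0.le hS0)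
    have h2 : 0 ≤ (1 - u) * (KR * |det|) := mul_nonneg (by linarith) (mul_nonneg hKR0 (abs_nonneg _))
    linarith
  have rE : (1 - u) * ((1 - u) * (KC * S) + (1 - u) * (KR * |det|)) ≤ E := by
    have h := (abs_sub_le_iff.mp (abs_sub_fl_le_eps_mul_abs hp1 hfl he₄ (gE₁.add gE₂))).1
    rw [abs_of_nonneg hE12] at h
    have h1u : 0 ≤ 1 - u := by linarith
    have := mul_le_mul_of_nonneg_left (add_le_add rE₁ rE₂) h1u
    rw [hE]; linarith
  have htest : E ≤ |dC| := by
    rcases hT with h | h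
    · exact h.trans (le_abs_self _)
    · exact h.trans (neg_le_abs _)
  -- the remaining hypotheses of the core inequality
  have hcc : |c| ≤ 2 * u * (1 + u) ^ 4 * s := by
    have hc1 : |c| ≤ (1 + u) * |m₁ - m₂| := by
      have := abs_sub_abs_le_abs_sub c (m₁ - m₂); rw [abs_sub_comm c] at this; linarith
    have hm1 : |m₁| ≤ (1 + u) * (|f₁| + |f₂|) := by
      have := abs_sub_abs_le_abs_sub m₁ (f₁ + f₂); rw [abs_sub_comm m₁] at this
      linarith [abs_add_le f₁ f₂, mul_le_mul_of_nonneg_left (abs_add_le f₁ f₂) hu0.le]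
    have hm2 : |m₂| ≤ (1 + u) * (|f₃| + |f₄|) := by
      have := abs_sub_abs_le_abs_sub m₂ (f₃ + f₄); rw [abs_sub_comm m₂] at this
      linarith [abs_add_le f₃ f₄, mul_le_mul_of_nonneg_left (abs_add_le f₃ f₄) hu0.le]
    have hf1 : |f₁| ≤ (1 + u) * |P₁| := by
      have := abs_sub_abs_le_abs_sub f₁ P₁; rw [abs_sub_comm f₁] at this; linarith
    have hf2 : |f₂| ≤ (1 + u) * |P₂| := by
      have := abs_sub_abs_le_abs_sub f₂ P₂; rw [abs_sub_comm f₂] at this; linarith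
    have hf3 : |f₃| ≤ (1 + u) * |P₃| := by
      have := abs_sub_abs_le_abs_sub f₃ P₃; rw [abs_sub_comm f₃] at this; linarith
    have hf4 : |f₄| ≤ (1 + u) * |P₄| := by
      have := abs_sub_abs_le_abs_sub f₄ P₄; rw [abs_sub_comm f₄] at this; linarith
    have h1u : 0 ≤ 1 + u := by linarith
    have hPs : |P₁| + |P₂| + |P₃| + |P₄| ≤ 2 * u * (1 + u) * s := by rw [hs_def]; linarith
    calc |c| ≤ (1 + u) * |m₁ - m₂| := hc1
      _ ≤ (1 + u) * (|m₁| + |m₂|) := mul_le_mul_of_nonneg_left (abs_sub _ _) h1u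
      _ ≤ (1 + u) * ((1 + u) * (|f₁| + |f₂|) + (1 + u) * (|f₃| + |f₄|)) :=
          mul_le_mul_of_nonneg_left (add_le_add hm1 hm2) h1u
      _ = (1 + u) ^ 2 * (|f₁| + |f₂| + |f₃| + |f₄|) := by ring
      _ ≤ (1 + u) ^ 2 * ((1 + u) * |P₁| + (1 + u) * |P₂| + (1 + u) * |P₃| + (1 + u) * |P₄|) :=
          mul_le_mul_of_nonneg_left (by linarith) (by positivity)
      _ = (1 + u) ^ 3 * (|P₁| + |P₂| + |P₃| + |P₄|) := by ring
      _ ≤ (1 + u) ^ 3 * (2 * u * (1 + u) * s) := mul_le_mul_of_nonneg_left hPs (by positivity)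
      _ = 2 * u * (1 + u) ^ 4 * s := by ring
  have hcL : |c - (P₁ + P₂ - (P₃ + P₄))| ≤ u * |c| + 2 * u ^ 2 * (1 + u) * (2 + u) * s := by
    have hdec : c - (P₁ + P₂ - (P₃ + P₄)) = -(m₁ - m₂ - c) - (f₁ + f₂ - m₁) + (f₃ + f₄ - m₂)
        - (P₁ - f₁) - (P₂ - f₂) + (P₃ - f₃) + (P₄ - f₄) := by ring
    have hf12 : |f₁ + f₂| ≤ (1 + u) * (|P₁| + |P₂|) := by
      have a := abs_add_le f₁ f₂
      have b1 := abs_sub_abs_le_abs_sub f₁ P₁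
      have b2 := abs_sub_abs_le_abs_sub f₂ P₂
      rw [abs_sub_comm f₁] at b1
      rw [abs_sub_comm f₂] at b2
      linarith
    have hf34 : |f₃ + f₄| ≤ (1 + u) * (|P₃| + |P₄|) := by
      have a := abs_add_le f₃ f₄
      have b3 := abs_sub_abs_le_abs_sub f₃ P₃
      have b4 := abs_sub_abs_le_abs_sub f₄ P₄
      rw [abs_sub_comm f₃] at b3
      rw [abs_sub_comm f₄] at b4
      linarith
    have htri : |c - (P₁ + P₂ - (P₃ + P₄))| ≤ |m₁ - m₂ - c| + |f₁ + f₂ - m₁| + |f₃ + f₄ - m₂|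
        + |P₁ - f₁| + |P₂ - f₂| + |P₃ - f₃| + |P₄ - f₄| := by
      rw [hdec]
      have t1 := abs_add_le (-(m₁ - m₂ - c) - (f₁ + f₂ - m₁) + (f₃ + f₄ - m₂) - (P₁ - f₁) - (P₂ - f₂)
        + (P₃ - f₃)) (P₄ - f₄)
      have t2 := abs_add_le (-(m₁ - m₂ - c) - (f₁ + f₂ - m₁) + (f₃ + f₄ - m₂) - (P₁ - f₁) - (P₂ - f₂))
        (P₃ - f₃)
      have t3 := abs_sub (-(m₁ - m₂ - c) - (f₁ + f₂ - m₁) + (f₃ + f₄ - m₂) - (P₁ - f₁)) (P₂ - f₂)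
      have t4 := abs_sub (-(m₁ - m₂ - c) - (f₁ + f₂ - m₁) + (f₃ + f₄ - m₂)) (P₁ - f₁)
      have t5 := abs_add_le (-(m₁ - m₂ - c) - (f₁ + f₂ - m₁)) (f₃ + f₄ - m₂)
      have t6 := abs_sub (-(m₁ - m₂ - c)) (f₁ + f₂ - m₁)
      have t7 : |-(m₁ - m₂ - c)| = |m₁ - m₂ - c| := abs_neg _
      linarith
    have hu12 : u * |f₁ + f₂| ≤ u * ((1 + u) * (|P₁| + |P₂|)) := mul_le_mul_of_nonneg_left hf12 hu0.le
    have hu34 : u * |f₃ + f₄| ≤ u * ((1 + u) * (|P₃| + |P₄|)) := mul_le_mul_of_nonneg_left hf34 hu0.le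
    have k1 := mul_le_mul_of_nonneg_left bP₁ hu0.le
    have k2 := mul_le_mul_of_nonneg_left bP₂ hu0.le
    have k3 := mul_le_mul_of_nonneg_left bP₃ hu0.le
    have k4 := mul_le_mul_of_nonneg_left bP₄ hu0.le
    have k5 := mul_le_mul_of_nonneg_left (add_le_add bP₁ bP₂) (by positivity : (0 : ℚ) ≤ u * (1 + u))
    have k6 := mul_le_mul_of_nonneg_left (add_le_add bP₃ bP₄) (by positivity : (0 : ℚ) ≤ u * (1 + u))
    rw [hs_def]
    linarith [htri, rc, rm₁, rm₂, rf₁, rf₂, rf₃, rf₄, hu12, hu34, k1, k2, k3, k4, k5, k6]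
  have hτ : |τ₁ * τ₂ - τ₃ * τ₄| ≤ u ^ 2 * (1 + u) * s := by
    have h12 : |τ₁ * τ₂| ≤ u ^ 2 * ((1 + u) * |x₅|) := by
      rw [abs_mul]
      calc |τ₁| * |τ₂| ≤ (u * |x₁|) * (u * |x₂|) :=
            mul_le_mul rτ₁ rτ₂ (abs_nonneg _) (by positivity)
        _ = u ^ 2 * |x₁ * x₂| := by rw [abs_mul]; ring
        _ ≤ u ^ 2 * ((1 + u) * |x₅|) := mul_le_mul_of_nonneg_left hP5 (by positivity)
    have h34 : |τ₃ * τ₄| ≤ u ^ 2 * ((1 + u) * |x₆|) := by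
      rw [abs_mul]
      calc |τ₃| * |τ₄| ≤ (u * |x₃|) * (u * |x₄|) :=
            mul_le_mul rτ₃ rτ₄ (abs_nonneg _) (by positivity)
        _ = u ^ 2 * |x₃ * x₄| := by rw [abs_mul]; ring
        _ ≤ u ^ 2 * ((1 + u) * |x₆|) := mul_le_mul_of_nonneg_left hP6 (by positivity)
    calc |τ₁ * τ₂ - τ₃ * τ₄| ≤ |τ₁ * τ₂| + |τ₃ * τ₄| := abs_sub _ _
      _ ≤ u ^ 2 * ((1 + u) * |x₅|) + u ^ 2 * ((1 + u) * |x₆|) := add_le_add h12 h34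
      _ = u ^ 2 * (1 + u) * s := by rw [hs_def]; ring
  have hTdec : t₁ * t₂ - t₃ * t₄ = (x₁ * x₂ - x₃ * x₄) + (P₁ + P₂ - (P₃ + P₄)) + (τ₁ * τ₂ - τ₃ * τ₄) := by
    rw [hP₁, hP₂, hP₃, hP₄, hτ₁, hτ₂, hτ₃, hτ₄]; ring
  have hdC' : |dC - (det + c)| ≤ u * |dC| := by rw [abs_sub_comm]; exact rdC
  -- the core inequality
  have hnum := stageC_sign_of_bounds hu0 hu16 hs.le hS hTdec hdB hcL hcc hτ hdC' hKC hKR rE htest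
  -- `d ≠ 0`, hence the equivalences
  have hE0 : 0 < E := by
    have h1 : (1 - u) * s ≤ S := by linarith [(abs_sub_le_iff.mp hS).1]
    have h1u : (0 : ℚ) < 1 - u := by linarith
    have h2 : 0 < (1 - u) * ((1 - u) * (KC * S)) :=
      mul_pos h1u (mul_pos h1u (mul_pos hKC0 (lt_of_lt_of_le (mul_pos h1u hs) h1)))
    have h3 : 0 ≤ (1 - u) * ((1 - u) * (KR * |det|)) :=
      mul_nonneg h1u.le (mul_nonneg h1u.le (mul_nonneg hKR0 (abs_nonneg _)))
    linarith
  have hd0 : dC ≠ 0 := by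
    intro h; rw [h, abs_zero] at htest; linarith
  rcases lt_or_gt_of_ne hd0 with hneg | hpos
  · have hsig := hnum.2 hneg
    exact ⟨⟨fun h => absurd h (not_lt.mpr hneg.le), fun h => absurd h (not_lt.mpr hsig.le)⟩,
      ⟨fun _ => hsig, fun _ => hneg⟩⟩
  · have hsig := hnum.1 hpos
    exact ⟨⟨fun _ => hsig, fun _ => hpos⟩,
      ⟨fun h => absurd h (not_lt.mpr hpos.le), fun h => absurd h (not_lt.mpr hsig.le)⟩⟩

end Summit.Ventures.CertifiedArithmetic.Expansions
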